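import Literature.NumberTheory.GaloisCohomology.Howard2004.ResidualTauEvaluationProofs
import HarnessLib

/-!
# Howard 2004, Lemma 1.5.3: at an inert prime, the Frobenius value of an unramified `τ`-eigenclass
# is an eigenvector of the involution `θ ∘ ρ̄(δ_q)` of `T̄` (theorems only)

Topic `NumberTheory/GaloisCohomology/Howard2004`. THEOREMS ONLY: no definition, no named fact, no
instance, no notation, no `sorry`. Cell `pub/bsd-print-x9`, print leaf G87
`Literature.NumberTheory.GaloisCohomology.Howard2004.thm161_dvrKolyvaginBound`; seat `bsd-line-x10b-p1-w5`
g7 ([EIG-LOC] step 4 of the Lemma 1.5.3 chain; sequel to `ResidualTauEvaluationProofs` and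
`InertLocalTauProofs`).

SOURCE. B. Howard, Compositio Math. **140** (2004) = arXiv:1202.6340, Lemma 1.5.3 proof (p. 10
L12–16): «the action of complex conjugation splits `H¹_f(K_ℓ, T̄)` … into one-dimensional eigenspaces
by H.5 and the isomorphisms `H¹_f(K_ℓ, T̄) ≅ T̄` … of Proposition 1.1.7» (evaluation at Frobenius,
p. 5 L137–138).

WHAT IS PROVED. Let `q` be INERT (`h : cd.σ • q = q`), `Γ_{K_q}` acting trivially on `T̄`, `F ∈ Γ_{K_q}`
an element whose local transport `φ_q F`, read back at `q` along `h`, differs from `F` by inertia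
(`F⁻¹ · (h ▸ φ_q F) ∈ I_{K_q}`; for a Frobenius lift and the canonical datum this is «`φ_q` respects
Frobenius»), and `c ∈ H¹(K, T̄)` a global `τ`-eigenclass UNRAMIFIED at `q`. Then the Frobenius value
`w = eval_F (loc_q c) ∈ T̄` satisfies **`θ (ρ̄(δ_q) w) = ± w`**
(`ResidualTau.theta_delta_evalClass_localization_of_semilinearH_eq[_neg]`): the image of
`H¹_{𝓕}(K, T̄)^± ∩ loc_q⁻¹ H¹_f` under `H¹_f(K_q, T̄) ≅ T̄` lies in the `±`-eigenspace of the involution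
`Θ_q = θ ∘ ρ̄(δ_q)` (= `ρ̄_ℚ(Frob_ℓ)` for the canonical datum; = `θ` when `ρ̄(δ_q) = 1`, e.g. for the
primes produced by Lemma 1.6.2). With `evalClass_bijective_unramified` (injective on `H¹_ur`) this is
the eigenLINE bound of Lemma 1.5.3 as soon as `ker(Θ_q ∓ 1)` is a line. Also: `trivial_of_eq` (trivial
local action transported along `v = w`).

NOT HERE: `ker(Θ_q ∓ 1)` is a line (H.5(a) for `Θ_q`; or `det Θ_q = −1`), `H¹_s`/transverse side;
`thm161_dvrKolyvaginBound` is NOT proved; no summit statement is proved; the Birch–Swinnerton-Dyer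
conjecture is not proved by any of this.
References: [Howard2004HeegnerKolyvagin] Prop. 1.1.7, §1.3 H.5, Lemma 1.5.3.
-/

set_option autoImplicit false

noncomputable section

open Function NumberField IsDedekindDomain Field
open scoped NumberField ContRepresentation

namespace Literature.NumberTheory.GaloisCohomology.Howard2004

open Literature.NumberTheory.GaloisRepresentations
open Literature.NumberTheory.GaloisRepresentations.DiscreteGaloisModule
open Literature.NumberTheory.EllipticCurves

variable {K : Type} [Field K] [NumberField K] {Nbar : Type} [AddCommGroup Nbar]
  [TopologicalSpace Nbar] [DiscreteTopology Nbar]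

/-- Trivial local action transports along an equality of places `h : v = w`.
[cite: Howard2004HeegnerKolyvagin, §1.3 (arXiv p. 7 L44–48, read at `λ̄ = λ`)] -/
theorem trivial_of_eq (ρbar : DiscreteGaloisModule K Nbar) {v w : HeightOneSpectrum (𝓞 K)} (h : v = w)
    (htw : ∀ (σ : absoluteGaloisGroup (w.adicCompletion K)) (x : Nbar), GaloisRep.toLocal w ρbar σ x = x) :
    ∀ (σ : absoluteGaloisGroup (v.adicCompletion K)) (x : Nbar), GaloisRep.toLocal v ρbar σ x = x := by
  subst h
  exact htw

namespace ResidualTau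

variable {R : Type} [CommRing R] [Module R Nbar] {cd : ConjugationDatum K} {ρbar : DiscreteGaloisModule K Nbar}

/-- **The Frobenius value of an unramified `τ`-FIXED class is fixed by `Θ_q = θ ∘ ρ̄(δ_q)`**: for an
inert `q` (`h : σ • q = q`), trivial local action, `F ∈ Γ_{K_q}` with `F⁻¹ · (h ▸ φ_q F) ∈ I_{K_q}`, and
a global class `c` with `τ_* c = c` and `loc_q c ∈ H¹_ur(K_q, T̄)`:
`θ (ρ̄(δ_q) (eval_F (loc_q c))) = eval_F (loc_q c)`.
[cite: Howard2004HeegnerKolyvagin, Lemma 1.5.3 proof (arXiv p. 10 L12–16) with Prop. 1.1.7 (p. 5 L137–138)] -/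
theorem theta_delta_evalClass_localization_of_semilinearH_eq (A : ResidualTau (R := R) cd ρbar)
    {q : HeightOneSpectrum (𝓞 K)} (h : cd.σ • q = q)
    (htriv : ∀ (σ : absoluteGaloisGroup (q.adicCompletion K)) (x : Nbar), GaloisRep.toLocal q ρbar σ x = x)
    (F : absoluteGaloisGroup (q.adicCompletion K))
    (hF : F⁻¹ * (h ▸ cd.φ q F : absoluteGaloisGroup (q.adicCompletion K)) ∈ absInertia (q.adicCompletion K))
    {c : galoisCohomology ρbar 1}
    (hc : semilinearH cd.isLift A.θ.toAddMonoidHom A.isSemilinear 1 c = c)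
    (hur : galoisCohomology.localization ρbar (Sum.inr q) 1 c ∈ unramifiedSubgroup (GaloisRep.toLocal q ρbar) 1) :
    A.θ (ρbar (cd.δ q) (evalClass (GaloisRep.toLocal q ρbar) htriv F
        (galoisCohomology.localization ρbar (Sum.inr q) 1 c))) =
      evalClass (GaloisRep.toLocal q ρbar) htriv F (galoisCohomology.localization ρbar (Sum.inr q) 1 c) := by
  have htriv' := trivial_of_eq ρbar h htriv
  -- `eval_F (loc_q c) = θ (ρ̄ δ (eval_{φ F} (loc_{σ q} c)))`
  have h1 := A.evalClass_localization_of_semilinearH_eq q htriv htriv' F hc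
  -- `eval_{φ F} (loc_{σ q} c) = eval_{h ▸ φ F} (loc_q c) = eval_F (loc_q c)`
  have h2 : evalClass (GaloisRep.toLocal (cd.σ • q) ρbar) htriv' (cd.φ q F)
      (galoisCohomology.localization ρbar (Sum.inr (cd.σ • q)) 1 c) =
      evalClass (GaloisRep.toLocal q ρbar) htriv F (galoisCohomology.localization ρbar (Sum.inr q) 1 c) := by
    rw [← cast_evalClass_localization ρbar h htriv' htriv (cd.φ q F) c]
    exact evalClass_eq_of_mem_unramified (GaloisRep.toLocal q ρbar) htriv hF hur
  rw [h2] at h1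
  exact h1.symm

/-- **The Frobenius value of an unramified `τ`-ANTI-fixed class is anti-fixed by `Θ_q`**:
`τ_* c = -c`, `loc_q c ∈ H¹_ur` ⟹ `θ (ρ̄(δ_q) (eval_F (loc_q c))) = -eval_F (loc_q c)`.
[cite: Howard2004HeegnerKolyvagin, Lemma 1.5.3 proof (arXiv p. 10 L12–16) with Prop. 1.1.7 (p. 5 L137–138)] -/
theorem theta_delta_evalClass_localization_of_semilinearH_eq_neg (A : ResidualTau (R := R) cd ρbar)
    {q : HeightOneSpectrum (𝓞 K)} (h : cd.σ • q = q)
    (htriv : ∀ (σ : absoluteGaloisGroup (q.adicCompletion K)) (x : Nbar), GaloisRep.toLocal q ρbar σ x = x)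
    (F : absoluteGaloisGroup (q.adicCompletion K))
    (hF : F⁻¹ * (h ▸ cd.φ q F : absoluteGaloisGroup (q.adicCompletion K)) ∈ absInertia (q.adicCompletion K))
    {c : galoisCohomology ρbar 1}
    (hc : semilinearH cd.isLift A.θ.toAddMonoidHom A.isSemilinear 1 c = -c)
    (hur : galoisCohomology.localization ρbar (Sum.inr q) 1 c ∈ unramifiedSubgroup (GaloisRep.toLocal q ρbar) 1) :
    A.θ (ρbar (cd.δ q) (evalClass (GaloisRep.toLocal q ρbar) htriv F
        (galoisCohomology.localization ρbar (Sum.inr q) 1 c))) =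
      -evalClass (GaloisRep.toLocal q ρbar) htriv F (galoisCohomology.localization ρbar (Sum.inr q) 1 c) := by
  have htriv' := trivial_of_eq ρbar h htriv
  have h1 := A.evalClass_localization_of_semilinearH_eq_neg q htriv htriv' F hc
  have h2 : evalClass (GaloisRep.toLocal (cd.σ • q) ρbar) htriv' (cd.φ q F)
      (galoisCohomology.localization ρbar (Sum.inr (cd.σ • q)) 1 c) =
      evalClass (GaloisRep.toLocal q ρbar) htriv F (galoisCohomology.localization ρbar (Sum.inr q) 1 c) := by
    rw [← cast_evalClass_localization ρbar h htriv' htriv (cd.φ q F) c]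
    exact evalClass_eq_of_mem_unramified (GaloisRep.toLocal q ρbar) htriv hF hur
  rw [h2] at h1
  exact h1.symm

/-- **Injectivity companion**: two global classes unramified at `q` with the same Frobenius value at
`q` have the same localization at `q` (evaluation at a Frobenius lift is injective on `H¹_ur`,
`evalClass_eq_zero_of_mem_unramified`); so `c ↦ eval_F (loc_q c)` embeds `loc_q (H¹_𝓕(K, T̄)^± ∩ loc_q⁻¹ H¹_f)`
into the `±`-eigenspace of `Θ_q` on `T̄`. [cite: Howard2004HeegnerKolyvagin, Prop. 1.1.7 (arXiv p. 5 L129–138)] -/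
theorem localization_eq_of_evalClass_eq
    {q : HeightOneSpectrum (𝓞 K)}
    (htriv : ∀ (σ : absoluteGaloisGroup (q.adicCompletion K)) (x : Nbar), GaloisRep.toLocal q ρbar σ x = x)
    {F : absoluteGaloisGroup (q.adicCompletion K)} (hFrob : IsFrobPow F 1)
    {c d : galoisCohomology ρbar 1}
    (hc : galoisCohomology.localization ρbar (Sum.inr q) 1 c ∈ unramifiedSubgroup (GaloisRep.toLocal q ρbar) 1)
    (hd : galoisCohomology.localization ρbar (Sum.inr q) 1 d ∈ unramifiedSubgroup (GaloisRep.toLocal q ρbar) 1)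
    (heq : evalClass (GaloisRep.toLocal q ρbar) htriv F (galoisCohomology.localization ρbar (Sum.inr q) 1 c) =
      evalClass (GaloisRep.toLocal q ρbar) htriv F (galoisCohomology.localization ρbar (Sum.inr q) 1 d)) :
    galoisCohomology.localization ρbar (Sum.inr q) 1 c = galoisCohomology.localization ρbar (Sum.inr q) 1 d := by
  have hsub : galoisCohomology.localization ρbar (Sum.inr q) 1 (c - d) =
      galoisCohomology.localization ρbar (Sum.inr q) 1 c - galoisCohomology.localization ρbar (Sum.inr q) 1 d :=
    map_sub _ c d
  have hmem : galoisCohomology.localization ρbar (Sum.inr q) 1 (c - d) ∈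
      unramifiedSubgroup (GaloisRep.toLocal q ρbar) 1 := by
    rw [hsub]
    exact sub_mem hc hd
  have hval : evalClass (GaloisRep.toLocal q ρbar) htriv F
      (galoisCohomology.localization ρbar (Sum.inr q) 1 (c - d)) = 0 := by
    rw [hsub]
    exact (map_sub (evalClass (GaloisRep.toLocal q ρbar) htriv F) _ _).trans (by rw [heq, sub_self])
  have h0 := evalClass_eq_zero_of_mem_unramified (GaloisRep.toLocal q ρbar) htriv hFrob hmem hval
  have h1 : galoisCohomology.localization ρbar (Sum.inr q) 1 c -
      galoisCohomology.localization ρbar (Sum.inr q) 1 d = 0 := by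
    rw [← hsub]
    exact h0
  exact sub_eq_zero.mp h1

end ResidualTau

end Literature.NumberTheory.GaloisCohomology.Howard2004
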